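import Summits.ResolutionOfSingularities.ResolutionOfSingularities.Theorems.WildConesCampaignW46ForcedAtomExitBound
import Summits.ResolutionOfSingularities.ResolutionOfSingularities.Theorems.WildConesCampaignW46ForcedAtomFiniteField
import Summits.ResolutionOfSingularities.ResolutionOfSingularities.Theorems.WildConesCampaignW46ForcedAtomRational
import Summits.ResolutionOfSingularities.ResolutionOfSingularities.Theorems.WildConesCampaignW46EffectiveTermination
import HarnessLib

/-!
# [OURS · L1 W4.6, rung (i) WITH A NUMBER in EVERY dimension — brick 22] THE FINITE-SEQUENCE EXIT BOUND in the
# forced-atom regime for ALL `n ≥ 1` and ALL primes `p`: `CampaignW46.FinLocalExitBound (Regime.forcedAtom n)` over every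
# algebraically closed field, with the bound `μ + 1` (Milnor number plus one) at EVERY presentation
# (cell res-hironaka, LADDER-RESOLUTION rung L, D-0089; slot W4.6, seat res-L1-s46-pv-2 gen 4; host route `WildCones`,
# crux `ClassicalRegimes` stmt-ResolutionOfSingularities-16884, `--supports … --as helper`)

HONEST FRAMING. Everything here is OURS. NOTHING below is a statement of H. Hironaka's manuscript [Hironaka2017] and
nothing asserts that any statement of it holds: res-L1-type-o1's `FinPermissibleRun` / `FinLocalExitBound` (WORDING OF
RECORD of rung (i-a)′) and `Regime.forcedAtom` (p517839) and the typed candidate carriers of row 001 enter as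
DEFINITIONS; no FACT-LIST premise is used. AI review is weaker than expert review.

## What is proved (closing residue (R3) «no number for `n ≥ 3`, `p` odd» of this seat's gen-3 census)

* `ForcedAtom.exists_centres` — bookkeeping: in the forced-atom regime the centres of a finite permissible sequence are
  the singular points and lie over the singular point of stage `0`.
* `ForcedAtom.card_le_mu_succ_of_oneStep` — the CORE over a PERFECT field `K`, given a one-step oracle: **for EVERY
  `n ≥ 1`, EVERY prime `p`, every finite §2.1-permissible sequence inside `Regime.forcedAtom n`, every point `x` of stage
  `0` and EVERY formal presentation `E₀(f₀) = w₀·(z^p − ser c₀)` of `J_x`: the number of centres over `x` is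
  `≤ μ(c₀) + 1`.** The dictionary turns the sequence into ONE run of route `WildCones`' coefficient calculus with all
  blown-up states isolated of multiplicity `p`, and such a run has at most `μ(c₀) + 1` states (brick 21
  `EffectiveTermination.le_mu_of_isol_multP`: Milnor drop in the classical regimes `n ≤ 2 ∨ p = 2`, p480678; effective
  death of narrow runs for `p` odd, `n ≥ 3`, brick 20, fed with the Loewy bound `𝔪^μ ≤ jac c₀`). Since the bound holds
  for every presentation it is intrinsic (cf. brick 19 `mu_eq_of_span_eq`).
* `ForcedAtom.finLocalExitBound_of_card_le` — packaging into o1's `FinLocalExitBound` (`β = μ + 1` at presented points).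
* `finLocalExitBound_forcedAtom_allDim [IsAlgClosed K]`, `finLocalExitBound_forcedAtom_allDim_of_finite (hK : Finite K)`,
  `finLocalExitBound_allDim_of_le_forcedAtomRational [PerfectField K]` (antitone, `K`-rational singular points) —
  **`FinLocalExitBound (Regime.forcedAtom n)` for EVERY `n ≥ 1` and EVERY prime `p`** in the three field classes of this
  seat's dictionary (one steps p523688 / p526993 / p528983); were `n ≤ 2 ∨ p = 2` with bound `μ` (p524336 / p528213 /
  p529544). All-binders form `finLocalExitBound_forcedAtom_allDim_all` (`K` algebraically closed or finite). (The
  résumé-free rung `PermissiblyTerminates (Regime.forcedAtom n)` follows again through o1's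
  `permissiblyTerminates_of_finLocalExitBound`; it is p523688's `permissiblyTerminates_forcedAtom`, not restated.)

References: this seat's p523688 / p524336 / p526993 / p528213 / p528983 / p529544, bricks 20/21 (effective `NarrowRunsDie`
p534251, effective termination), p480678, res-L1-type-o1 p488284 / p517839; the tree's cruxes
`NarrowRunsDie` (stmt-16882) and `ConeExit` (stmt-16883) of route `WildCones`. [folklore]
-/

noncomputable section

-- single-problem summit: the doubled namespace component `ResolutionOfSingularities` is forced
set_option linter.dupNamespace false

open scoped BigOperators Classical
open MvPowerSeries IsLocalRing

namespace Summit.ResolutionOfSingularities.ResolutionOfSingularities.Theorems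

/-! ## The exit bound in every dimension -/

namespace CampaignW46.ForcedAtom

open CategoryTheory AlgebraicGeometry TopologicalSpace
open Literature.AlgebraicGeometry.Resolution
open Literature.AlgebraicGeometry.Hironaka2017.S02Preliminaries
open Literature.AlgebraicGeometry.Hironaka2017.Datum
open Scheme.IdealSheafData
open WildCones
open CampaignW46.AtomGerm

variable {p : ℕ} [Fact p.Prime] {K : Type} [Field K] [CharP K p] {n : ℕ}

/-- [OURS · L1 W4.6] **Bookkeeping in the forced-atom regime**: along a finite §2.1-permissible sequence all of whose stages
lie in `Regime.forcedAtom n`, every centre `D_k` (`k < len`) is the unique singular point `ξ_k` of its stage, consecutive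
singular points lie over each other, and all of them lie over `ξ_0`. [folklore] -/
theorem exists_centres (r : FinPermissibleRun p K)
    (hr : ∀ k, k ≤ r.len → Regime.forcedAtom (p := p) (K := K) n (r.A k) (r.E k)) (hlen : 0 < r.len) :
    ∃ ξ : ∀ k, k < r.len → (r.A k).Z,
      (∀ k (hk : k < r.len), (r.D k : Set (r.A k).Z) = {ξ k hk} ∧ (r.E k).sing = {ξ k hk}) ∧
      (∀ k (hk : k + 1 < r.len), r.π k (ξ (k + 1) hk) = ξ k (Nat.lt_of_succ_lt hk)) ∧
      (∀ k (hk : k < r.len), r.down k (ξ k hk) = ξ 0 hlen) := by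
  have hS : ∀ k, k ≤ r.len → (r.E k).sing.Subsingleton := fun k hk => (hr k hk).2.1
  have hcen : ∀ k, k < r.len → ∃ ξ : (r.A k).Z, (r.D k : Set (r.A k).Z) = {ξ} ∧ (r.E k).sing = {ξ} := by
    intro k hk
    obtain ⟨ξ, hξD⟩ := (r.permissible k hk).irreducible.nonempty
    have hξS : ξ ∈ (r.E k).sing := (r.permissible k hk).subset_sing hξD
    refine ⟨ξ, ?_, (hS k hk.le).eq_singleton_of_mem hξS⟩
    exact (Set.subsingleton_of_subset_singleton
      (((hS k hk.le).eq_singleton_of_mem hξS) ▸ (r.permissible k hk).subset_sing)).eq_singleton_of_mem hξD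
  choose ξ hξ using hcen
  have hξS : ∀ k (hk : k < r.len), ξ k hk ∈ (r.E k).sing := fun k hk => by
    rw [(hξ k hk).2]
    exact Set.mem_singleton _
  have hπξ : ∀ k (hk : k + 1 < r.len), r.π k (ξ (k + 1) hk) = ξ k (Nat.lt_of_succ_lt hk) := by
    intro k hk
    haveI : IsLocallyNoetherian (r.A (k + 1)).Z := ambient_isLocallyNoetherian _
    have hk' : k < r.len := Nat.lt_of_succ_lt hk
    have h1 : ξ (k + 1) hk ∈ ((r.E k).transform (r.π k) (r.D k)).sing := by
      rw [← r.E_succ k hk']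
      exact hξS (k + 1) hk
    exact hS k hk'.le (sing_subset_of_transform (r.blowup k hk') (r.E k) (r.permissible k hk').subset_sing h1)
      (hξS k hk')
  refine ⟨ξ, hξ, hπξ, ?_⟩
  intro k
  induction k with
  | zero => intro hk; rfl
  | succ k ih =>
    intro hk
    change (r.π k ≫ r.down k) (ξ (k + 1) hk) = ξ 0 hlen
    rw [Scheme.Hom.comp_apply, hπξ k hk, ih]

/-- [OURS · L1 W4.6 rung (i) WITH A NUMBER, EVERY dimension `n ≥ 1`, EVERY prime `p` — the CORE over a perfect field;
replaces the role of Th. 16.13 p.87 l.25–28 («by applying Th.(16.6) … repeatedly but FINITELY MANY times») of H. Hironaka's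
ms. (2017) read, résumé-free, on FINITE §2.1-permissible sequences restricted to the forced-atom regime, with a NUMBER; NOT a
statement of the manuscript] **In the forced-atom regime the number of blow-ups over a point is at most the Milnor number of
ANY formal presentation of the atom at that point, plus one** — for `K` perfect of characteristic `p`, `0 < n`, GIVEN a
one-step oracle `hstep` (the transform of a presented atom at the next singular point is presented by a successor state of
route `WildCones`' calculus; supplied by this seat's dictionary over algebraically closed `K`, p523688, finite `K`, p526993, or
at `K`-rational points, p526993/p528983): for every finite §2.1-permissible sequence inside `Regime.forcedAtom n`, every
point `x` of stage `0`, every presentation `E₀(f₀) = w₀·(z^p − ser c₀)` of `J_x` and every set `s` of indices of centres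
meeting the fibre over `x`: `#s ≤ μ(c₀) + 1`, and `#s ≤ μ(c₀)` in the classical regimes `n ≤ 2 ∨ p = 2` (Milnor drop,
p480678) — for EVERY presentation, not just the chosen one of p524336. [folklore] -/
theorem card_le_mu_succ_of_oneStep [PerfectField K] (hn : 0 < n) (r : FinPermissibleRun p K)
    (hr : ∀ k, k ≤ r.len → Regime.forcedAtom (p := p) (K := K) n (r.A k) (r.E k))
    (hstep : ∀ (k : ℕ) (_ : k + 1 < r.len) (ξ : (r.A k).Z), ξ ∈ (r.E k).sing → (r.D k : Set (r.A k).Z) = {ξ} →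
      ∀ (E₀ : AdicCompletion (maximalIdeal ((r.A k).Z.presheaf.stalk ξ)) ((r.A k).Z.presheaf.stalk ξ) ≃+*
          MvPowerSeries (Option (Fin n)) K)
        (f₀ : (r.A k).Z.presheaf.stalk ξ) (a : (Fin n → ℕ) → K) (w : MvPowerSeries (Option (Fin n)) K),
        stalkIdeal (r.E k).J ξ = Ideal.span {f₀} → IsUnit w →
        E₀ (algebraMap _ _ f₀) = w * ((X none : MvPowerSeries (Option (Fin n)) K) ^ p -
          rename (some : Fin n → Option (Fin n)) (ser p n K a)) → MultP p n K a →
        ∀ ξ' : (r.A (k + 1)).Z, ξ' ∈ ((r.E k).transform (r.π k) (r.D k)).sing → ξ' ∈ (r.E (k + 1)).sing →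
          IsClosed ({ξ'} : Set (r.A (k + 1)).Z) →
          ∃ (i₀ : Fin n) (τ : Fin n → K)
            (E₀' : AdicCompletion (maximalIdeal ((r.A (k + 1)).Z.presheaf.stalk ξ'))
              ((r.A (k + 1)).Z.presheaf.stalk ξ') ≃+* MvPowerSeries (Option (Fin n)) K)
            (f₀' : (r.A (k + 1)).Z.presheaf.stalk ξ') (w' : MvPowerSeries (Option (Fin n)) K),
            stalkIdeal ((r.E k).transform (r.π k) (r.D k)).J ξ' = Ideal.span {f₀'} ∧ IsUnit w' ∧
              E₀' (algebraMap _ _ f₀') = w' * ((X none : MvPowerSeries (Option (Fin n)) K) ^ p -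
                rename (some : Fin n → Option (Fin n)) (ser p n K (step p n K i₀ τ a))))
    (x : (r.A 0).Z) (s : Finset ℕ) (hs : ∀ m ∈ s, m < r.len ∧ ∃ y ∈ (r.D m : Set (r.A m).Z), r.down m y = x)
    (E₀ : AdicCompletion (maximalIdeal ((r.A 0).Z.presheaf.stalk x)) ((r.A 0).Z.presheaf.stalk x) ≃+*
      MvPowerSeries (Option (Fin n)) K)
    (f₀ : (r.A 0).Z.presheaf.stalk x) (c₀ : (Fin n → ℕ) → K) (w₀ : MvPowerSeries (Option (Fin n)) K)
    (hJ0 : stalkIdeal (r.E 0).J x = Ideal.span {f₀}) (hw0 : IsUnit w₀)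
    (hf0 : E₀ (algebraMap _ _ f₀) = w₀ * ((X none : MvPowerSeries (Option (Fin n)) K) ^ p -
      rename (some : Fin n → Option (Fin n)) (ser p n K c₀))) :
    s.card ≤ mu p n K c₀ + 1 ∧ (n ≤ 2 ∨ p = 2 → s.card ≤ mu p n K c₀) := by
  have hp : p.Prime := Fact.out
  -- the empty case
  rcases s.eq_empty_or_nonempty with hs0 | ⟨m₀, hm₀⟩
  · rw [hs0, Finset.card_empty]
    exact ⟨Nat.zero_le _, fun _ => Nat.zero_le _⟩
  have hlen : 0 < r.len := lt_of_le_of_lt (Nat.zero_le m₀) (hs m₀ hm₀).1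
  have hS : ∀ k, k ≤ r.len → (r.E k).sing.Subsingleton := fun k hk => (hr k hk).2.1
  obtain ⟨ξ, hξ, hπξ, hdown⟩ := exists_centres r hr hlen
  have hξS : ∀ k (hk : k < r.len), ξ k hk ∈ (r.E k).sing := fun k hk => by
    rw [(hξ k hk).2]
    exact Set.mem_singleton _
  have hcl : ∀ k (hk : k < r.len), IsClosed ({ξ k hk} : Set (r.A k).Z) := fun k hk => by
    rw [← (hξ k hk).1]
    exact (r.D k).isClosed
  -- `x` is the singular point of stage `0`
  have hx : x = ξ 0 hlen := by
    obtain ⟨hm₀len, y, hy, hyx⟩ := hs m₀ hm₀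
    rw [(hξ m₀ hm₀len).1, Set.mem_singleton_iff] at hy
    rw [← hyx, hy, hdown m₀ hm₀len]
  subst hx
  -- multiplicity `p` of a presented atom at a singular point of a stage in the regime
  have hmult : ∀ (k : ℕ) (hk : k < r.len)
      (E₀ : AdicCompletion (maximalIdeal ((r.A k).Z.presheaf.stalk (ξ k hk))) ((r.A k).Z.presheaf.stalk (ξ k hk)) ≃+*
        MvPowerSeries (Option (Fin n)) K)
      (f₀ : (r.A k).Z.presheaf.stalk (ξ k hk)) (a : (Fin n → ℕ) → K) (w : MvPowerSeries (Option (Fin n)) K),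
      stalkIdeal (r.E k).J (ξ k hk) = Ideal.span {f₀} → IsUnit w →
        E₀ (algebraMap _ _ f₀) = w * ((X none : MvPowerSeries (Option (Fin n)) K) ^ p -
          rename (some : Fin n → Option (Fin n)) (ser p n K a)) → Isol p n K a ∧ MultP p n K a := by
    intro k hk E₀ f₀ a w hJ hw hf₀
    haveI : IsRegularLocalRing ((r.A k).Z.presheaf.stalk (ξ k hk)) := ambient_isRegular (r.A k) _
    have hI : Isol p n K a := ((hr k hk.le).2.2 (ξ k hk) (hξS k hk)).2.2 E₀ f₀ a w hJ hw hf₀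
    have hf₀𝔪 : f₀ ∈ maximalIdeal ((r.A k).Z.presheaf.stalk (ξ k hk)) ^ p := by
      have h := hξS k hk
      change ((r.E k).b : ℕ∞) ≤ idealOrder (r.E k).J _ at h
      rw [le_idealOrder_iff, hJ, Ideal.span_singleton_le_iff_mem, (hr k hk.le).1] at h
      exact h
    exact ⟨hI, (transform_mem_pow_iff_multP E₀ hw a hf₀).2.mpr ⟨ThreefoldsCharTwo.ser_ne_zero_of_isol hn hI, hf₀𝔪⟩⟩
  -- presentations at `ξ_k`, `k < len`
  let P : ∀ k, k < r.len → Type := fun k hk =>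
    Σ' (E₀ : AdicCompletion (maximalIdeal ((r.A k).Z.presheaf.stalk (ξ k hk))) ((r.A k).Z.presheaf.stalk (ξ k hk)) ≃+*
        MvPowerSeries (Option (Fin n)) K)
      (f₀ : (r.A k).Z.presheaf.stalk (ξ k hk)) (a : (Fin n → ℕ) → K) (w : MvPowerSeries (Option (Fin n)) K),
      stalkIdeal (r.E k).J (ξ k hk) = Ideal.span {f₀} ∧ IsUnit w ∧
        E₀ (algebraMap _ _ f₀) = w * ((X none : MvPowerSeries (Option (Fin n)) K) ^ p -
          rename (some : Fin n → Option (Fin n)) (ser p n K a))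
  -- one run of the coefficient dynamics presenting every stage `k < len`, started at the GIVEN presentation
  have H : ∀ k (hk : k < r.len), ∃ (i : ℕ → Fin n) (t : ℕ → Fin n → K) (q : P k hk),
      run p n K c₀ i t k = q.2.2.1 ∧
        ∀ j ≤ k, Isol p n K (run p n K c₀ i t j) ∧ MultP p n K (run p n K c₀ i t j) := by
    intro k
    induction k with
    | zero =>
      intro hk
      refine ⟨fun _ => ⟨0, hn⟩, fun _ _ => 0, ⟨E₀, f₀, c₀, w₀, hJ0, hw0, hf0⟩, rfl, ?_⟩
      intro j hj
      obtain rfl : j = 0 := Nat.le_zero.mp hj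
      exact hmult 0 hk E₀ f₀ c₀ w₀ hJ0 hw0 hf0
    | succ k ih =>
      intro hk
      have hk' : k < r.len := Nat.lt_of_succ_lt hk
      obtain ⟨i, t, ⟨E₁, f₁, a, w, hJ, hw, hf₁⟩, hrun, hgood⟩ := ih hk'
      have hξ' : ξ (k + 1) hk ∈ ((r.E k).transform (r.π k) (r.D k)).sing := by
        rw [← r.E_succ k hk']
        exact hξS (k + 1) hk
      obtain ⟨i₀, τ, E₁', f₁', w', hJ', hw', hf₁'⟩ := hstep k hk (ξ k hk') (hξS k hk') (hξ k hk').1 E₁ f₁ a w hJ hw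
        hf₁ (hmult k hk' E₁ f₁ a w hJ hw hf₁).2 (ξ (k + 1) hk) hξ' (hξS (k + 1) hk) (hcl (k + 1) hk)
      have hJ'' : stalkIdeal (r.E (k + 1)).J (ξ (k + 1) hk) = Ideal.span {f₁'} := by
        rw [r.E_succ k hk']
        exact hJ'
      -- the extended word
      refine ⟨fun j => if j = k then i₀ else i j, fun j => if j = k then τ else t j,
        ⟨E₁', f₁', step p n K i₀ τ a, w', hJ'', hw', hf₁'⟩, ?_, ?_⟩
      · have hagree : run p n K c₀ (fun j => if j = k then i₀ else i j) (fun j => if j = k then τ else t j) k =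
            run p n K c₀ i t k :=
          run_congr c₀ k (fun j hj => if_neg (Nat.ne_of_lt hj)) (fun j hj => if_neg (Nat.ne_of_lt hj))
        change step p n K (if k = k then i₀ else i k) (if k = k then τ else t k)
          (run p n K c₀ (fun j => if j = k then i₀ else i j) (fun j => if j = k then τ else t j) k) = _
        rw [if_pos rfl, if_pos rfl, hagree, hrun]
      · intro j hj
        rcases Nat.lt_or_ge j (k + 1) with hjk | hjk
        · have hjk' : j ≤ k := Nat.lt_succ_iff.mp hjk
          have hagree_j : run p n K c₀ (fun l => if l = k then i₀ else i l) (fun l => if l = k then τ else t l) j =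
              run p n K c₀ i t j :=
            (run_congr c₀ j (i' := fun l => if l = k then i₀ else i l) (t' := fun l => if l = k then τ else t l)
              (fun l hl => (if_neg (Nat.ne_of_lt (lt_of_lt_of_le hl hjk'))).symm)
              (fun l hl => (if_neg (Nat.ne_of_lt (lt_of_lt_of_le hl hjk'))).symm)).symm
          rw [hagree_j]
          exact hgood j hjk'
        · have hj' : j = k + 1 := le_antisymm hj hjk
          subst hj'
          have hagree : run p n K c₀ (fun j => if j = k then i₀ else i j) (fun j => if j = k then τ else t j) k =
              run p n K c₀ i t k :=
            run_congr c₀ k (fun j hj => if_neg (Nat.ne_of_lt hj)) (fun j hj => if_neg (Nat.ne_of_lt hj))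
          have hstate : run p n K c₀ (fun j => if j = k then i₀ else i j) (fun j => if j = k then τ else t j)
              (k + 1) = step p n K i₀ τ a := by
            change step p n K (if k = k then i₀ else i k) (if k = k then τ else t k)
              (run p n K c₀ (fun j => if j = k then i₀ else i j) (fun j => if j = k then τ else t j) k) = _
            rw [if_pos rfl, if_pos rfl, hagree, hrun]
          rw [hstate]
          exact hmult (k + 1) hk E₁' f₁' (step p n K i₀ τ a) w' hJ'' hw' hf₁'
  -- the last blown-up stage `len - 1`
  obtain ⟨i, t, -, -, hgood⟩ := H (r.len - 1) (Nat.sub_lt hlen Nat.one_pos)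
  -- `s ⊆ {0, …, len - 1}`
  have hcard : s.card ≤ r.len := by
    calc s.card ≤ (Finset.range r.len).card :=
          Finset.card_le_card fun m hm => Finset.mem_range.mpr (hs m hm).1
      _ = r.len := Finset.card_range _
  -- an isolated multiplicity-`p` run has at most `μ(c₀) + 1` states (brick 21); `μ(c₀)` in the classical regimes
  have hL := EffectiveTermination.le_mu_of_isol_multP hp hn c₀ i t hgood
  refine ⟨by omega, fun hreg => ?_⟩
  obtain ⟨m, hmμ, hbad⟩ := classicalRegimes_exit_le_mu hp hn hreg K c₀ i t
  have hlenm : r.len ≤ m := by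
    by_contra hlt
    exact hbad (hgood m (by omega))
  omega

/-- [OURS · L1 W4.6] **From a bound at every presentation to `FinLocalExitBound`**: for a regime `Rg` contained in
`Regime.forcedAtom n`, if along every finite §2.1-permissible sequence in `Rg` the number of centres over a point `x` is
`≤ μ(c₀) + 1` for every presentation `c₀` at `x`, then `FinLocalExitBound Rg` with `β(A, E, x) = μ + 1` at presented points
and `0` elsewhere (no centre lies over an unpresented point: centres lie over the singular point, which is presented).
[folklore] -/
theorem finLocalExitBound_of_card_le (Rg : Regime p K)
    (hRg : ∀ (A : AmbientDatum p K) (E : IdealExponent A.Z), Rg A E → Regime.forcedAtom (p := p) (K := K) n A E)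
    (hcard : ∀ r : FinPermissibleRun p K, (∀ k, k ≤ r.len → Rg (r.A k) (r.E k)) →
      ∀ (x : (r.A 0).Z) (s : Finset ℕ), (∀ m ∈ s, m < r.len ∧ ∃ y ∈ (r.D m : Set (r.A m).Z), r.down m y = x) →
      ∀ (E₀ : AdicCompletion (maximalIdeal ((r.A 0).Z.presheaf.stalk x)) ((r.A 0).Z.presheaf.stalk x) ≃+*
          MvPowerSeries (Option (Fin n)) K)
        (f₀ : (r.A 0).Z.presheaf.stalk x) (c₀ : (Fin n → ℕ) → K) (w₀ : MvPowerSeries (Option (Fin n)) K),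
        stalkIdeal (r.E 0).J x = Ideal.span {f₀} → IsUnit w₀ →
        E₀ (algebraMap _ _ f₀) = w₀ * ((X none : MvPowerSeries (Option (Fin n)) K) ^ p -
          rename (some : Fin n → Option (Fin n)) (ser p n K c₀)) → s.card ≤ mu p n K c₀ + 1) :
    FinLocalExitBound Rg := by
  refine ⟨fun A E x =>
    if h : ∃ (E₀ : AdicCompletion (maximalIdeal (A.Z.presheaf.stalk x)) (A.Z.presheaf.stalk x) ≃+*
          MvPowerSeries (Option (Fin n)) K)
        (f₀ : A.Z.presheaf.stalk x) (c₀ : (Fin n → ℕ) → K) (w₀ : MvPowerSeries (Option (Fin n)) K),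
        stalkIdeal E.J x = Ideal.span {f₀} ∧ IsUnit w₀ ∧
          E₀ (algebraMap _ _ f₀) = w₀ * ((X none : MvPowerSeries (Option (Fin n)) K) ^ p -
            rename (some : Fin n → Option (Fin n)) (ser p n K c₀))
      then mu p n K h.choose_spec.choose_spec.choose + 1 else 0, ?_⟩
  intro r hr' x s hs
  have hr : ∀ k, k ≤ r.len → Regime.forcedAtom (p := p) (K := K) n (r.A k) (r.E k) := fun k hk => hRg _ _ (hr' k hk)
  dsimp only
  by_cases hex : ∃ (E₀ : AdicCompletion (maximalIdeal ((r.A 0).Z.presheaf.stalk x)) ((r.A 0).Z.presheaf.stalk x) ≃+*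
          MvPowerSeries (Option (Fin n)) K)
        (f₀ : (r.A 0).Z.presheaf.stalk x) (c₀ : (Fin n → ℕ) → K) (w₀ : MvPowerSeries (Option (Fin n)) K),
        stalkIdeal (r.E 0).J x = Ideal.span {f₀} ∧ IsUnit w₀ ∧
          E₀ (algebraMap _ _ f₀) = w₀ * ((X none : MvPowerSeries (Option (Fin n)) K) ^ p -
            rename (some : Fin n → Option (Fin n)) (ser p n K c₀))
  · rw [dif_pos hex]
    obtain ⟨w₀, hJ0, hw0, hf0⟩ := hex.choose_spec.choose_spec.choose_spec
    exact hcard r hr' x s hs hex.choose hex.choose_spec.choose hex.choose_spec.choose_spec.choose w₀ hJ0 hw0 hf0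
  · rw [dif_neg hex]
    -- no presentation at `x`: then no centre lies over `x`
    rcases s.eq_empty_or_nonempty with hs0 | ⟨m₀, hm₀⟩
    · rw [hs0, Finset.card_empty]
    exfalso
    have hlen : 0 < r.len := lt_of_le_of_lt (Nat.zero_le m₀) (hs m₀ hm₀).1
    obtain ⟨ξ, hξ, -, hdown⟩ := exists_centres r hr hlen
    have hx : x = ξ 0 hlen := by
      obtain ⟨hm₀len, y, hy, hyx⟩ := hs m₀ hm₀
      rw [(hξ m₀ hm₀len).1, Set.mem_singleton_iff] at hy
      rw [← hyx, hy, hdown m₀ hm₀len]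
    subst hx
    have hξS : ξ 0 hlen ∈ (r.E 0).sing := by
      rw [(hξ 0 hlen).2]
      exact Set.mem_singleton _
    exact hex ((hr 0 hlen.le).2.2 (ξ 0 hlen) hξS).2.1

/-! ## The three field classes of this seat's dictionary -/

/-- [OURS · L1 W4.6 rung (i) WITH A NUMBER, EVERY dimension `n ≥ 1`, EVERY prime `p`; replaces the role of Th. 16.13 p.87
l.25–28 of H. Hironaka's ms. (2017) read, résumé-free, on FINITE §2.1-permissible sequences restricted to the forced-atom
regime, in the exit-bound form of record (rung (i-a)′, `FinLocalExitBound`); NOT a statement of the manuscript] **Over an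
ALGEBRAICALLY CLOSED field: in the forced-atom regime the number of blow-ups of a permissible sequence over a point is bounded
— in EVERY dimension and EVERY characteristic — by the Milnor number of the atom at that point plus one** (`0 < n`; the
case `n ≤ 2 ∨ p = 2` with bound `μ` is p524336). [folklore] -/
theorem finLocalExitBound_forcedAtom_allDim [IsAlgClosed K] (hn : 0 < n) :
    FinLocalExitBound (Regime.forcedAtom (p := p) (K := K) n) :=
  finLocalExitBound_of_card_le _ (fun _ _ h => h) fun r hr x s hs E₀ f₀ c₀ w₀ hJ0 hw0 hf0 =>
    (card_le_mu_succ_of_oneStep hn r hr (fun k hk ξ hξ hD E₁ f₁ a w hJ hw hf₁ hM _ hξ' _ hcl =>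
      exists_presentation_transform_of_isBlowup (r.π k) (r.D k) (r.blowup k (Nat.lt_of_succ_lt hk))
        (r.hom_eq k (Nat.lt_of_succ_lt hk)) (hr k (Nat.lt_of_succ_lt hk).le).1 (hr k (Nat.lt_of_succ_lt hk).le).2.1
        hξ hD ((hr k (Nat.lt_of_succ_lt hk).le).2.2 ξ hξ).1 E₁ f₁ a w hJ hw hf₁ hM hξ' hcl)
      x s hs E₀ f₀ c₀ w₀ hJ0 hw0 hf0).1

/-- [OURS · L1 W4.6 rung (i) WITH A NUMBER, EVERY dimension, EVERY prime; NOT a statement of the manuscript] **Over a FINITE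
field**: `FinLocalExitBound (Regime.forcedAtom n)` for every `n ≥ 1` (bound `μ + 1`; the case `n ≤ 2 ∨ p = 2` with bound
`μ` is p528213), through the one step of brick 17 (residue fields of presented points are `K`). [folklore] -/
theorem finLocalExitBound_forcedAtom_allDim_of_finite (hK : Finite K) (hn : 0 < n) :
    FinLocalExitBound (Regime.forcedAtom (p := p) (K := K) n) := by
  haveI := hK
  refine finLocalExitBound_of_card_le _ (fun _ _ h => h) fun r hr x s hs E₀ f₀ c₀ w₀ hJ0 hw0 hf0 =>
    (card_le_mu_succ_of_oneStep hn r hr (fun k hk ξ hξ hD E₁ f₁ a w hJ hw hf₁ hM ξ' hξ' hξ'S _ => ?_)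
      x s hs E₀ f₀ c₀ w₀ hJ0 hw0 hf0).1
  haveI : IsRegularLocalRing ((r.A (k + 1)).Z.presheaf.stalk ξ') := ambient_isRegular (r.A (k + 1)) _
  obtain ⟨E₂, -, -, -, -⟩ := ((hr (k + 1) hk.le).2.2 ξ' hξ'S).2.1
  exact exists_presentation_transform_of_finite (r.π k) (r.D k) (r.blowup k (Nat.lt_of_succ_lt hk))
    (hr k (Nat.lt_of_succ_lt hk).le).1 (hr k (Nat.lt_of_succ_lt hk).le).2.1 hξ hD
    ((hr k (Nat.lt_of_succ_lt hk).le).2.2 ξ hξ).1 E₁ f₁ a w hJ hw hf₁ hM hξ' (nonempty_residueField_equiv_of_presentation E₂)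

/-- [OURS · L1 W4.6 rung (i) WITH A NUMBER, EVERY dimension, EVERY prime; NOT a statement of the manuscript] **Over a PERFECT
field, at `K`-rational singular points** (antitone form): for every regime `Rg` contained in `Regime.forcedAtom n` all of
whose singular points are `K`-rational, `FinLocalExitBound Rg` for every `n ≥ 1` (bound `μ + 1`; the case `n ≤ 2 ∨ p = 2`
with bound `μ` is p529544), through the one step of brick 17 at rational points. [folklore] -/
theorem finLocalExitBound_allDim_of_le_forcedAtomRational [PerfectField K] (hn : 0 < n) (Rg : Regime p K)
    (hRg : ∀ (A : AmbientDatum p K) (E : IdealExponent A.Z), Rg A E →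
      Regime.forcedAtom (p := p) (K := K) n A E ∧ ∀ ξ ∈ E.sing, ∀ y : A.Z.presheaf.stalk ξ, ∃ l : K,
          y - (A.Z.presheaf.germ ⊤ ξ trivial).hom (sectionConst A.hom ⊤ l) ∈ maximalIdeal (A.Z.presheaf.stalk ξ)) :
    FinLocalExitBound Rg := by
  refine finLocalExitBound_of_card_le Rg (fun A E h => (hRg A E h).1) fun r hr' x s hs E₀ f₀ c₀ w₀ hJ0 hw0 hf0 => ?_
  have hr : ∀ k, k ≤ r.len → Regime.forcedAtom (p := p) (K := K) n (r.A k) (r.E k) := fun k hk => (hRg _ _ (hr' k hk)).1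
  refine (card_le_mu_succ_of_oneStep hn r hr (fun k hk ξ hξ hD E₁ f₁ a w hJ hw hf₁ hM ξ' hξ' hξ'S _ => ?_)
    x s hs E₀ f₀ c₀ w₀ hJ0 hw0 hf0).1
  exact exists_presentation_transform_of_rat (r.π k) (r.D k) (r.blowup k (Nat.lt_of_succ_lt hk))
    (hr k (Nat.lt_of_succ_lt hk).le).1 (hr k (Nat.lt_of_succ_lt hk).le).2.1 hξ hD
    ((hr k (Nat.lt_of_succ_lt hk).le).2.2 ξ hξ).1 E₁ f₁ a w hJ hw hf₁ hM hξ'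
    (exists_sub_stalkMap_mem_maximalIdeal_of_kRational (r.π k) (r.A k).hom (r.A (k + 1)).hom
      (r.hom_eq k (Nat.lt_of_succ_lt hk)) ξ' ((hRg _ _ (hr' (k + 1) hk.le)).2 ξ' hξ'S))

omit [Fact p.Prime] [CharP K p] in
/-- [OURS · L1 W4.6 rung (i) WITH A NUMBER in EVERY dimension; NOT a statement of the manuscript] The exit bound with
every binder explicit: for every prime `p`, every field `K` of characteristic `p` which is algebraically closed OR finite,
and every `n ≥ 1`, `FinLocalExitBound (Regime.forcedAtom n)`. [folklore] -/
theorem finLocalExitBound_forcedAtom_allDim_all :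
    ∀ (p : ℕ) [Fact p.Prime] (K : Type) [Field K] [CharP K p] (_ : IsAlgClosed K ∨ Finite K) (n : ℕ), 0 < n →
      FinLocalExitBound (Regime.forcedAtom (p := p) (K := K) n) := by
  intro p _ K _ _ hK n hn
  rcases hK with hK | hK
  · haveI := hK
    exact finLocalExitBound_forcedAtom_allDim hn
  · exact finLocalExitBound_forcedAtom_allDim_of_finite hK hn

end CampaignW46.ForcedAtom

end Summit.ResolutionOfSingularities.ResolutionOfSingularities.Theorems

end
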